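import Literature.Barriers.CriticalPhenomena.PlaquetteWalkHoleRootHoleColumn
import HarnessLib

/-!
# Barrier catalogue (SAWScalingLimit): THE GENERAL PREFIX-LOOP SEPARATION LEMMA — a point of the excursion polygon
joined to the lower corner of the root edge by lattice sides that the prefix cannot cross

Leaf of `PlaquetteWalkHoleRootPrefixLoop` (the prefix loop `C` of a class-`B2a` UNDER-walk at the far cell of a hole
root, its winding number `ΩG.windC`, one winding number along the excursion polygon `J` (`ΩG.windC_pJ_edge`), the jump
across the root edge `ΩG.windC_jump`) through `PlaquetteWalkHoleRootHoleColumn` (the lower east and its west edges, the cut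
of the second order law below). Setting: root plaquette `w` rooted at `W`, hole `holeFaceW w = (w.1 − 1, w.2) ∉ D`,
far cell `farW w = (w.1 − 2, w.2)`; `ω` a class-`B2a` walk at the far cell with first side `S` (an under-walk); `F` its
first hit of the far cell, so that the PREFIX mid-edges are `nth 1, …, nth F` (`nth F` = the far cell's `S` side).

The tree holds FOUR hand-made instances of one argument — `ΩG.exists_prefix_nth_eq_root_S` (`PrefixLoop` §4: an excursion
through `rootE.S` forces the prefix through `w.S`), `ΩG.false_of_under_excursion_rootSS_W` (`DeadDoorBelow` §1: dead door),
`ΩG.false_of_under_excursion_ray_oneLiveColumn` (`RootNotchLiveColumn` §1: one live ray column),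
`ΩG.false_of_under_excursion_westEdge_oneLiveRow` (`OneLiveRow` §1: one live row below) — each re-running the same
winding-number bookkeeping along a different lattice path. This file states and proves the argument ONCE, for an
ARBITRARY lattice path:

§0 ★ `not_mem_sideSeg_of_mem_fSeg_hSeg` — the two closing segments of `C` through the far cell and the hole (`fSeg`,
`hSeg`) meet a closed lattice side only if that side is the hole's `W` side, the root edge `w.W`, or the far cell's `S`
side (coordinates; replaces the three ad-hoc row/column versions of the parent files).
§1 «free sides»: a closed lattice side `c.side s` is FREE when it is neither the hole's `W` side nor the root edge and is
no prefix mid-edge (`nth i ≠ c.side s` for `1 ≤ i ≤ F`); ★ `ΩG.windC_eq_of_subset_sideSeg_free` — `C` has the same winding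
number at the two ends of any segment contained in a free side (so the far cell's `S` side, `= nth F`, is excluded
automatically). Dischargers: `ΩG.prefix_nth_ne_of_not_mem` (a DEAD side — one of its two faces absent — is no mid-edge of the
walk at all), `ΩG.prefix_nth_ne_of_exit` (an EXIT MID-EDGE OF A SLOT of the excursion polygon is no prefix mid-edge: a
mid-edge is used once), `ΩG.prefix_nth_ne_farW_side` (no side of the far cell other than `S`), `ΩG.exit_ne_holeFaceW_W` /
`ΩG.exit_ne_root_W` (an exit mid-edge is neither the hole's `W` side nor the root).
§2 ★★ `ΩG.windC_chain` — TRANSPORT ALONG A FREE CHAIN: points `P 0, …, P K` with every segment `[P k, P (k+1)]` inside a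
free side have one winding number of `C`.
§3 ★★ `ΩG.windC_cHi_eq_windC_pJ` — the winding number of `C` along `J` is its winding number about the UPPER corner of the
root edge (the far cell's `N` midpoint is on `J` — one of exit/return of an under-walk is `N` — and is joined to that corner
along the top sides of the far cell and of the hole); ★★ `ΩG.windC_cLo_ne_windC_pJ` — hence NOT the one about the LOWER
corner (`windC_jump`); ★★ `ΩG.not_mem_pJ_edge_of_chain` — no point joined to the lower corner by a free chain lies on `J`.
§4 ★★★★★ `ΩG.false_of_free_chain_exit` — **THE GENERAL SEPARATION LEMMA**: if a free chain from the lower corner of the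
root edge ends on a closed side `c.side s` that is the exit mid-edge of some slot of `J`, contradiction. Corner form
★★★★★ `ΩG.false_of_cornerChain_exit` for lattice paths given by unit steps between lattice corners (`cornerPt`), the form
the applications use; the four step lemmas `segment_cornerPt_east/north/west/south` identify the side walked.
§5 FIRST CONSEQUENCES (no parity input; every domain with the hole absent, every class-`B2a` under-walk):
★★★★ `ΩG.exit_ne_root_S_of_under` / `ΩG.exit_ne_rootS_W_of_under` — THE LOWER-CORNER LAW: no slot of the excursion polygon
exits through the bottom side of the root plaquette `w.S`, nor through the west side of `rootS w` (the two crossable lattice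
sides hanging from the lower corner of the root edge; chains of length zero). So in the parent's eastern dichotomy
(`ΩG.kindsIn_rootS_or_root_eq_of_AJ_ne_zero_under`: «`w` doubles or `rootS` doubles») the first branch is void for the
canonical orientation, as the lane's census saw (FINDING-YB-KILL-FORCED-ZEROS §8 add. 2: `rootS` doubled in 128/128,
2 048/2 048 wound under-walks).
★★★★★ `ΩG.exists_prefix_nth_eq_slant_lt_of_exit` — THE ORDER LAW ON THE EASTERN RAY: if a slot of `J` exits through the
ray edge `slant x' w.2` (`x' ≥ w.1`), the PREFIX crosses a ray edge `slant x w.2` with `w.1 ≤ x < x'` — the prefix meets the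
bottom line of the root row east of the hole STRICTLY WEST of every excursion crossing (`PrefixLoop` §4 is `x' = w.1 + 1`,
`RootNotchLiveColumn` §1 its contrapositive with dead columns in between).
★★★★★ `ΩG.exists_prefix_nth_eq_vert_gt_of_exit` — THE ORDER LAW ON THE ROOT COLUMN BELOW: if a slot exits through
`vert w.1 y'` (`y' ≤ w.2 − 1`), the prefix crosses some `vert w.1 y` with `y' < y ≤ w.2 − 1` (`DeadDoorBelow` §1 and
`OneLiveRow` §1 are the contrapositives with dead sides in between).
The parity inputs (eastern ray count, `HoleColumn`) that turn these into «no wound under-walk» statements are applied in the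
companion leaf `PlaquetteWalkHoleRootRayOrderLaw`.

Not in print (the printed sources root walks on the outer boundary, where no excursion winds around the root); elementary
given the parent's loop `C`. Venture lane «pcv-sawmu», seat b-step0 gen 29 (FINDING-YB-KILL-FORCED-ZEROS §27: «all four
separations are instances of ONE principle … recommended to the heir as the tool»).

References: R. Courant, H. Robbins, *What is Mathematics?* (1941/1958), Ch. V Appendix §2 (the Jordan curve theorem for
polygons: the even–odd rule, the order of a point) [CourantRobbins1958]; L. V. Ahlfors, *Complex Analysis*, 3rd ed. (1979),
Ch. 4 §2.1 (the index of a point with respect to a closed curve; constancy on components) [AhlforsCA1979]; A. Glazman,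
Electron. Commun. Probab. 20 (2015) no. 86, Lemma 3.1, proof pp. 6–7 (the classes of walks through a rhombus)
[Glazman2015WeightedSAW]; A. Glazman, I. Manolescu, arXiv:1708.00395v3, §1 (the lattice, mid-edges, Fig. 1–2)
[GlazmanManolescu2019].
-/

noncomputable section

open Set Function Complex
open Literature.Topology.PlaneTopology

namespace Literature.Probability.RandomPlanarGeometry.SAW.YangBaxter

open Real

open private mem_segment_toC sideSeg_coords_W sideSeg_coords_E sideSeg_coords_S sideSeg_coords_N eq_of_two_mem
  eq_side_of_mem_crossSeg_sideSeg not_mem_sideSeg_of_mem_arcSeg toC_midPt_side_mem_sideSeg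
  from Literature.Probability.RandomPlanarGeometry.YangBaxterSAWExcursionJordan

open private len_eq side_jOut segment_pJ_even
  from Literature.Probability.RandomPlanarGeometry.YangBaxterSAWExcursionJordan

open private fSeg_coords hSeg_coords toC_midPt_mem_crossSeg
  from Literature.Barriers.CriticalPhenomena.PlaquetteWalkHoleRootPrefixLoop

/-! ## §0 Which closed lattice sides meet the two closing segments of the prefix loop -/

section Segs

variable (w : Face)

/-- Integer helper: `0 ≤ 2d + 3 ≤ 1` forces `d = -1`. [folklore] -/
private theorem eq_neg_one_of_two_mul_add_three {d : ℤ} (h0 : (0 : ℝ) ≤ 2 * d + 3) (h1 : (2 : ℝ) * d + 3 ≤ 1) :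
    d = -1 := by
  have h0' : (0 : ℤ) ≤ 2 * d + 3 := by exact_mod_cast h0
  have h1' : (2 * d + 3 : ℤ) ≤ 1 := by exact_mod_cast h1
  omega

/-- ★ **The closing segments of the prefix loop meet only three closed lattice sides**: a closed side `c.side s` other
than the hole's `W` side `vert (w.1 − 1) w.2`, the root edge `vert w.1 w.2` and the far cell's `S` side
`slant (w.1 − 2) w.2` misses both the segment `fSeg w` inside the far cell and the segment `hSeg w` through the hole.
[cite: CourantRobbins1958, Ch. V Appendix §2 (The Jordan Curve Theorem for Polygons: the even–odd rule)] -/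
theorem not_mem_sideSeg_of_mem_fSeg_hSeg {c : Face} {s : Side} (h1 : c.side s ≠ (holeFaceW w).side .W)
    (h2 : c.side s ≠ w.side .W) (h3 : c.side s ≠ (farW w).side .S) {q : ℂ} (hq : q ∈ fSeg w ∨ q ∈ hSeg w) :
    q ∉ sideSeg c s := by
  intro hq'
  obtain ⟨c1, c2⟩ := c
  cases s with
  | W =>
    obtain ⟨hx, hy0, hy1⟩ := sideSeg_coords_W hq'
    simp only at hx hy0 hy1
    rcases hq with hq | hq
    · obtain ⟨t, ht0, ht1, hx', hy'⟩ := fSeg_coords w hq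
      have ht : t = 2 * ((c1 - w.1 : ℤ) : ℝ) + 3 := by push_cast; linarith
      have hd := eq_neg_one_of_two_mul_add_three (by rw [← ht]; exact ht0) (by rw [← ht]; exact ht1)
      have hc1 : c1 = w.1 - 1 := by omega
      have ht1' : t = 1 := by rw [ht, hd]; norm_num
      rw [ht1'] at hy'
      have hc2 : c2 = w.2 := (eq_of_two_mem (j := w.2) (c := c2) (by linarith) (by linarith)).symm
      apply h1; rw [hc1, hc2]; rfl
    · obtain ⟨hy, hx0, hx1⟩ := hSeg_coords w hq
      have hc2 : c2 = w.2 := (eq_of_two_mem (j := w.2) (c := c2) (by linarith) (by linarith)).symm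
      have h0 : (4 * w.1 - 4 : ℤ) ≤ 4 * c1 := by exact_mod_cast (show (4 * w.1 - 4 : ℝ) ≤ 4 * c1 by linarith)
      have h1' : (4 * c1 : ℤ) ≤ 4 * w.1 + 1 := by exact_mod_cast (show (4 * c1 : ℝ) ≤ 4 * w.1 + 1 by linarith)
      rcases (show c1 = w.1 - 1 ∨ c1 = w.1 by omega) with hc1 | hc1
      · apply h1; rw [hc1, hc2]; rfl
      · apply h2; rw [hc1, hc2]
  | E =>
    obtain ⟨hx, hy0, hy1⟩ := sideSeg_coords_E hq'
    simp only at hx hy0 hy1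
    rcases hq with hq | hq
    · obtain ⟨t, ht0, ht1, hx', hy'⟩ := fSeg_coords w hq
      have ht : t = 2 * ((c1 + 1 - w.1 : ℤ) : ℝ) + 3 := by push_cast; linarith
      have hd := eq_neg_one_of_two_mul_add_three (by rw [← ht]; exact ht0) (by rw [← ht]; exact ht1)
      have hc1 : c1 + 1 = w.1 - 1 := by omega
      have ht1' : t = 1 := by rw [ht, hd]; norm_num
      rw [ht1'] at hy'
      have hc2 : c2 = w.2 := (eq_of_two_mem (j := w.2) (c := c2) (by linarith) (by linarith)).symm
      apply h1
      show MidEdge.vert (c1 + 1) c2 = MidEdge.vert ((w.1 - 1, w.2) : Face).1 ((w.1 - 1, w.2) : Face).2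
      rw [hc1, hc2]
    · obtain ⟨hy, hx0, hx1⟩ := hSeg_coords w hq
      have hc2 : c2 = w.2 := (eq_of_two_mem (j := w.2) (c := c2) (by linarith) (by linarith)).symm
      have h0 : (4 * w.1 - 4 : ℤ) ≤ 4 * (c1 + 1) := by
        exact_mod_cast (show (4 * w.1 - 4 : ℝ) ≤ 4 * (c1 + 1) by linarith)
      have h1' : (4 * (c1 + 1) : ℤ) ≤ 4 * w.1 + 1 := by
        exact_mod_cast (show (4 * (c1 + 1) : ℝ) ≤ 4 * w.1 + 1 by linarith)
      rcases (show c1 + 1 = w.1 - 1 ∨ c1 + 1 = w.1 by omega) with hc1 | hc1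
      · apply h1
        show MidEdge.vert (c1 + 1) c2 = MidEdge.vert ((w.1 - 1, w.2) : Face).1 ((w.1 - 1, w.2) : Face).2
        rw [hc1, hc2]
      · apply h2
        show MidEdge.vert (c1 + 1) c2 = MidEdge.vert w.1 w.2
        rw [hc1, hc2]
  | S =>
    obtain ⟨hy, hx0, hx1⟩ := sideSeg_coords_S hq'
    simp only at hy hx0 hx1
    rcases hq with hq | hq
    · obtain ⟨t, ht0, ht1, hx', hy'⟩ := fSeg_coords w hq
      have ht : t = 2 * ((c2 - w.2 : ℤ) : ℝ) := by push_cast; linarith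
      have h0 : (0 : ℤ) ≤ 2 * (c2 - w.2) := by exact_mod_cast (show (0 : ℝ) ≤ 2 * ((c2 - w.2 : ℤ) : ℝ) by rw [← ht]; exact ht0)
      have h1' : (2 * (c2 - w.2) : ℤ) ≤ 1 := by exact_mod_cast (show (2 : ℝ) * ((c2 - w.2 : ℤ) : ℝ) ≤ 1 by rw [← ht]; exact ht1)
      have hc2 : c2 = w.2 := by omega
      have ht0' : t = 0 := by rw [ht, hc2]; push_cast; ring
      rw [ht0'] at hx'
      have h2' : (4 * c1 : ℤ) ≤ 4 * w.1 - 6 := by exact_mod_cast (show (4 * c1 : ℝ) ≤ 4 * w.1 - 6 by linarith)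
      have h3' : (4 * w.1 - 6 : ℤ) ≤ 4 * c1 + 4 := by exact_mod_cast (show (4 * w.1 - 6 : ℝ) ≤ 4 * c1 + 4 by linarith)
      have hc1 : c1 = w.1 - 2 := by omega
      apply h3; rw [hc1, hc2]; rfl
    · obtain ⟨hy', -, -⟩ := hSeg_coords w hq
      have : (4 * c2 : ℤ) = 4 * w.2 + 2 := by exact_mod_cast (show (4 * c2 : ℝ) = 4 * w.2 + 2 by linarith)
      omega
  | N =>
    obtain ⟨hy, hx0, hx1⟩ := sideSeg_coords_N hq'
    simp only at hy hx0 hx1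
    rcases hq with hq | hq
    · obtain ⟨t, ht0, ht1, hx', hy'⟩ := fSeg_coords w hq
      have ht : t = 2 * ((c2 + 1 - w.2 : ℤ) : ℝ) := by push_cast; linarith
      have h0 : (0 : ℤ) ≤ 2 * (c2 + 1 - w.2) := by
        exact_mod_cast (show (0 : ℝ) ≤ 2 * ((c2 + 1 - w.2 : ℤ) : ℝ) by rw [← ht]; exact ht0)
      have h1' : (2 * (c2 + 1 - w.2) : ℤ) ≤ 1 := by
        exact_mod_cast (show (2 : ℝ) * ((c2 + 1 - w.2 : ℤ) : ℝ) ≤ 1 by rw [← ht]; exact ht1)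
      have hc2 : c2 + 1 = w.2 := by omega
      have hz : ((c2 + 1 - w.2 : ℤ) : ℝ) = 0 := by exact_mod_cast (show c2 + 1 - w.2 = 0 by omega)
      have ht0' : t = 0 := by rw [ht, hz, mul_zero]
      rw [ht0'] at hx'
      have h2' : (4 * c1 : ℤ) ≤ 4 * w.1 - 6 := by exact_mod_cast (show (4 * c1 : ℝ) ≤ 4 * w.1 - 6 by linarith)
      have h3' : (4 * w.1 - 6 : ℤ) ≤ 4 * c1 + 4 := by exact_mod_cast (show (4 * w.1 - 6 : ℝ) ≤ 4 * c1 + 4 by linarith)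
      have hc1 : c1 = w.1 - 2 := by omega
      apply h3
      show MidEdge.slant c1 (c2 + 1) = MidEdge.slant ((w.1 - 2, w.2) : Face).1 ((w.1 - 2, w.2) : Face).2
      rw [hc1, hc2]
    · obtain ⟨hy', -, -⟩ := hSeg_coords w hq
      have : (4 * (c2 + 1) : ℤ) = 4 * w.2 + 2 := by
        exact_mod_cast (show (4 * (c2 + 1) : ℝ) = 4 * w.2 + 2 by linarith)
      omega

/-! ### Lattice corners and the unit steps between them -/

/-- One step EAST between lattice corners walks the bottom side of the face at the first corner.
[cite: GlazmanManolescu2019, §1 (the lattice of rhombi and its mid-edges)] -/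
theorem segment_cornerPt_east (q : ℤ × ℤ) :
    segment ℝ (toC (cornerPt q)) (toC (cornerPt (q.1 + 1, q.2))) = sideSeg (q : Face) .S := by
  rw [sideSeg]; congr 2 <;> (obtain ⟨a, b⟩ := q; simp [cornerPt, Face.base, Side.endA, Side.endB]; try ring)

/-- One step NORTH between lattice corners walks the west side of the face at the first corner.
[cite: GlazmanManolescu2019, §1 (the lattice of rhombi and its mid-edges)] -/
theorem segment_cornerPt_north (q : ℤ × ℤ) :
    segment ℝ (toC (cornerPt q)) (toC (cornerPt (q.1, q.2 + 1))) = sideSeg (q : Face) .W := by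
  rw [sideSeg]; congr 2 <;> (obtain ⟨a, b⟩ := q; simp [cornerPt, Face.base, Side.endA, Side.endB]; try ring)

/-- One step WEST between lattice corners walks the bottom side of the face west of the first corner.
[cite: GlazmanManolescu2019, §1 (the lattice of rhombi and its mid-edges)] -/
theorem segment_cornerPt_west (q : ℤ × ℤ) :
    segment ℝ (toC (cornerPt q)) (toC (cornerPt (q.1 - 1, q.2))) = sideSeg ((q.1 - 1, q.2) : Face) .S := by
  rw [sideSeg, segment_symm]; congr 2 <;> (obtain ⟨a, b⟩ := q; simp [cornerPt, Face.base, Side.endA, Side.endB]; try ring)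

/-- One step SOUTH between lattice corners walks the west side of the face south of the first corner.
[cite: GlazmanManolescu2019, §1 (the lattice of rhombi and its mid-edges)] -/
theorem segment_cornerPt_south (q : ℤ × ℤ) :
    segment ℝ (toC (cornerPt q)) (toC (cornerPt (q.1, q.2 - 1))) = sideSeg ((q.1, q.2 - 1) : Face) .W := by
  rw [sideSeg, segment_symm]; congr 2 <;> (obtain ⟨a, b⟩ := q; simp [cornerPt, Face.base, Side.endA, Side.endB]; try ring)

/-- A lattice corner lying on a closed side: the first corner of the side. [folklore] -/
private theorem toC_cornerPt_mem_sideSeg_endA (c : Face) (s : Side) : toC (c.base + s.endA) ∈ sideSeg c s :=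
  left_mem_segment _ _ _

/-- A lattice corner lying on a closed side: the second corner of the side. [folklore] -/
private theorem toC_cornerPt_mem_sideSeg_endB (c : Face) (s : Side) : toC (c.base + s.endB) ∈ sideSeg c s :=
  right_mem_segment _ _ _

end Segs

namespace ΩG

/-- The lower corner of the root edge is the lattice corner `(w.1, w.2)`. [cite: GlazmanManolescu2019, §1 (the lattice of rhombi and its mid-edges)] -/
theorem cLo_eq_toC_cornerPt (w : Face) : cLo w = toC (cornerPt w) := by
  rw [cLo]; congr 1; obtain ⟨a, b⟩ := w; simp [cornerPt, Face.base, Side.endA]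

/-- The upper corner of the root edge is the lattice corner `(w.1, w.2 + 1)`. [cite: GlazmanManolescu2019, §1 (the lattice of rhombi and its mid-edges)] -/
theorem cHi_eq_toC_cornerPt (w : Face) : cHi w = toC (cornerPt (w.1, w.2 + 1)) := by
  rw [cHi]; congr 1; obtain ⟨a, b⟩ := w; simp [cornerPt, Face.base, Side.endB]; ring

variable {D : Set Face} {w : Face} {ω : ΩG D (w.side .W) (farW w)}

/-! ## §1 Free sides: transport of `windC` across one side, and the dischargers -/

/-- ★ **Transport across a free side.** Hole absent, `ω` a class-`B2a` under-walk (first side `S`); a segment contained in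
a closed lattice side `c.side s` that is neither the hole's `W` side nor the root edge and is no prefix mid-edge
(`nth i ≠ c.side s` for `1 ≤ i ≤ F`). Then the prefix loop has the same winding number at the two ends of the segment.
[cite: AhlforsCA1979, Ch. 4 §2.1 (index of a point with respect to a closed curve)]
[cite: CourantRobbins1958, Ch. V Appendix §2 (The Jordan Curve Theorem for Polygons: the even–odd rule)] -/
theorem windC_eq_of_subset_sideSeg_free (hh : holeFaceW w ∉ D) (h : ω.IsB2a) (hS : ω.2.firstSideG = .S)
    {c : Face} {s : Side} (h1 : c.side s ≠ (holeFaceW w).side .W) (h2 : c.side s ≠ w.side .W)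
    (hpre : ∀ i, 1 ≤ i → i ≤ ω.2.firstHitG → ω.2.nth i ≠ c.side s)
    {p q : ℂ} (hpq : segment ℝ p q ⊆ sideSeg c s) : ω.windC p = ω.windC q := by
  have h3 : c.side s ≠ (farW w).side .S := by
    intro e
    apply hpre ω.2.firstHitG ω.one_le_firstHitG_far le_rfl
    rw [ω.2.nth_firstHitG, hS, e]
  refine windC_eq_of_segment fun z hz k hk hzk => ?_
  obtain ⟨i, hi1, hiF, e⟩ := exists_nth_eq_of_mem_pCedge_sideSeg hh h hS hk hzk (hpq hz)
    (fun q hq => not_mem_sideSeg_of_mem_fSeg_hSeg w h1 h2 h3 hq)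
  exact hpre i hi1 hiF e

/-- **A DEAD side is no mid-edge of the walk** (before its last one): if one of the two faces of `e` is absent from `D`
then `nth i ≠ e` for `1 ≤ i < n`; in particular for every prefix index `i ≤ F`.
[cite: Glazman2015WeightedSAW, Lemma 3.1 (proof, pp. 6–7: the classes of walks through a rhombus)] -/
theorem prefix_nth_ne_of_not_mem (h : ω.IsB2a) {e : MidEdge} (he : e.faces.1 ∉ D ∨ e.faces.2 ∉ D) :
    ∀ i, 1 ≤ i → i ≤ ω.2.firstHitG → ω.2.nth i ≠ e := by
  intro i hi1 hiF hie
  have hF := ω.fh_lt h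
  have hd := ω.2.door_nth (j := i) (by omega) (by omega)
  rw [hie] at hd
  rcases he with he | he
  · exact he hd.1
  · exact he hd.2

/-- **An exit mid-edge of a slot of the excursion polygon is no prefix mid-edge** (a mid-edge of a self-avoiding walk is
crossed once: the exit mid-edge of slot `j` is `nth (F + j + 1)`).
[cite: Glazman2015WeightedSAW, Lemma 3.1 (proof, pp. 6–7: the classes of walks through a rhombus)] -/
theorem prefix_nth_ne_of_exit (hr : RootedFace D (w.side .W) (farW w)) (h : ω.IsB2a) {e : MidEdge}
    (hJ : ∃ j, j < ω.Mv ∧ (ω.jFace h j).side (ω.jOut hr h j) = e) :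
    ∀ i, 1 ≤ i → i ≤ ω.2.firstHitG → ω.2.nth i ≠ e := by
  intro i hi1 hiF hie
  have hlen : ω.2.arcs.length = ω.2.firstHitG + ω.Mv := len_eq h
  obtain ⟨j, hj, hje⟩ := hJ
  rw [← hje, side_jOut (hr := hr) h hj] at hie
  have := ω.2.nth_inj (by omega) (by omega) hie
  omega

/-- **No side of the far cell other than its `S` side is a prefix mid-edge** (the first hit is the first index at which
the walk meets `∂(farW w)`, and it meets it through `S`).
[cite: Glazman2015WeightedSAW, Lemma 3.1 (proof, pp. 6–7: the first crossing of ∂r)] -/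
theorem prefix_nth_ne_farW_side (h : ω.IsB2a) (hS : ω.2.firstSideG = .S) {s : Side} (hs : s ≠ .S) :
    ∀ i, 1 ≤ i → i ≤ ω.2.firstHitG → ω.2.nth i ≠ (farW w).side s := by
  intro i hi1 hiF e
  have hF := ω.fh_lt h
  have hle := firstHitG_le_of_nth_eq (ω := ω) (by omega) e
  have ei : i = ω.2.firstHitG := by omega
  rw [ei, ω.2.nth_firstHitG, hS] at e
  exact hs (Face.side_injective (farW w) e).symm

/-- The two faces of the hole's `W` side are the far cell and the hole. [cite: GlazmanManolescu2019, §1 (mid-edges)] -/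
theorem holeFaceW_side_W_faces (w : Face) : ((holeFaceW w).side .W).faces = (farW w, holeFaceW w) := by
  obtain ⟨a, b⟩ := w
  simp only [holeFaceW, farW, Face.side, MidEdge.faces, Prod.mk.injEq, and_true]
  ring

/-- **An exit mid-edge of a slot is not the hole's `W` side** (hole absent): the exit mid-edge of slot `j` is
`nth (F + j + 1)`; before the last index it is a door (both faces present), and the last mid-edge is the far cell's
return side, `W` or `N` for an under-walk, whereas the hole's `W` side is the far cell's `E` side.
[cite: Glazman2015WeightedSAW, Lemma 3.1 (proof, pp. 6–7: the classes of walks through a rhombus)] -/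
theorem exit_ne_holeFaceW_W (hh : holeFaceW w ∉ D) (hr : RootedFace D (w.side .W) (farW w)) (h : ω.IsB2a)
    (hS : ω.2.firstSideG = .S) {j : ℕ} (hj : j < ω.Mv) :
    (ω.jFace h j).side (ω.jOut hr h j) ≠ (holeFaceW w).side .W := by
  intro e
  have hF := ω.fh_lt h
  have hlen : ω.2.arcs.length = ω.2.firstHitG + ω.Mv := len_eq h
  rw [side_jOut (hr := hr) h hj] at e
  rcases Nat.lt_or_ge (ω.2.firstHitG + j + 1) ω.2.arcs.length with hlt | hge
  · have hd := ω.2.door_nth (j := ω.2.firstHitG + j + 1) (by omega) hlt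
    rw [e, holeFaceW_side_W_faces] at hd
    exact hh hd.2
  · have heq : ω.2.firstHitG + j + 1 = ω.2.arcs.length := by omega
    rw [heq, ω.2.nth_length] at e
    -- the return side of an under-walk is `W` or `N`, not `E`
    have hWE : (holeFaceW w).side .W = (farW w).side .E := by
      obtain ⟨a, b⟩ := w; simp [holeFaceW, farW, Face.side]; ring
    rw [hWE] at e
    have h1 := Face.side_injective (farW w) e
    rcases fst_eq_W_or_N hh hr h hS with h' | h' <;> rw [h'] at h1 <;> exact absurd h1 (by decide)

/-- **An exit mid-edge of a slot is not the root edge.** [cite: Glazman2015WeightedSAW, Lemma 3.1 (proof, pp. 6–7)] -/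
theorem exit_ne_root_W (hr : RootedFace D (w.side .W) (farW w)) (h : ω.IsB2a) {j : ℕ} (hj : j < ω.Mv) :
    (ω.jFace h j).side (ω.jOut hr h j) ≠ w.side .W :=
  exit_ne_root (hr := hr) h hj

/-! ## §2 Transport along a free chain -/

/-- ★★ **TRANSPORT ALONG A FREE CHAIN.** Hole absent, `ω` a class-`B2a` under-walk; points `P 0, …, P K` such that every
segment `[P k, P (k + 1)]` (`k < K`) is contained in a closed side `(c k).side (s k)` that is neither the hole's `W` side nor
the root edge and is no prefix mid-edge. Then the prefix loop has ONE winding number at all the `P k`, `k ≤ K`.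
[cite: AhlforsCA1979, Ch. 4 §2.1 (index of a point with respect to a closed curve)]
[cite: CourantRobbins1958, Ch. V Appendix §2 (The Jordan Curve Theorem for Polygons: the even–odd rule)] -/
theorem windC_chain (hh : holeFaceW w ∉ D) (h : ω.IsB2a) (hS : ω.2.firstSideG = .S)
    {P : ℕ → ℂ} {c : ℕ → Face} {s : ℕ → Side} {K : ℕ}
    (hseg : ∀ k, k < K → segment ℝ (P k) (P (k + 1)) ⊆ sideSeg (c k) (s k))
    (h1 : ∀ k, k < K → (c k).side (s k) ≠ (holeFaceW w).side .W) (h2 : ∀ k, k < K → (c k).side (s k) ≠ w.side .W)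
    (hpre : ∀ k, k < K → ∀ i, 1 ≤ i → i ≤ ω.2.firstHitG → ω.2.nth i ≠ (c k).side (s k)) :
    ∀ k, k ≤ K → ω.windC (P k) = ω.windC (P 0) := by
  intro k
  induction k with
  | zero => intro _; rfl
  | succ k ih =>
    intro hk
    rw [← ih (by omega)]
    exact (windC_eq_of_subset_sideSeg_free hh h hS (h1 k hk) (h2 k hk) (hpre k hk) (hseg k hk)).symm

/-! ## §3 The winding number of the prefix loop along `J` is the one about the upper corner, not the lower -/

/-- ★★ **The winding number of `C` along `J` is its winding number about the UPPER corner of the root edge**: the far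
cell's `N` midpoint lies on `J` (one of the exit and return sides of an under-walk is `N`) and is joined to that corner
along the top side of the hole (dead) and the right half of the top side of the far cell (no prefix mid-edge).
[cite: AhlforsCA1979, Ch. 4 §2.1 (index of a point with respect to a closed curve)]
[cite: Glazman2015WeightedSAW, Lemma 3.1 (proof, pp. 6–7: the classes of walks through a rhombus)] -/
theorem windC_cHi_eq_windC_pJ (hh : holeFaceW w ∉ D) (hr : RootedFace D (w.side .W) (farW w)) (h : ω.IsB2a)
    (hS : ω.2.firstSideG = .S) : ω.windC (cHi w) = ω.windC (ω.pJ hr h 0) := by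
  have hM := ω.three_le_Mv hr h
  set q1 : ℂ := toC ((holeFaceW w).base + Side.N.endA) with hq1
  set mN : ℂ := toC (midPt ((farW w).side .N)) with hmN
  -- the top side of the hole: dead
  have hP1 : segment ℝ (cHi w) q1 ⊆ sideSeg (holeFaceW w) .N := by
    have : segment ℝ (cHi w) q1 = sideSeg (holeFaceW w) .N := by
      rw [segment_symm, sideSeg, cHi]
      congr 2
      obtain ⟨a, b⟩ := w; simp [holeFaceW, Face.base, Side.endB]; ring
    rw [this]
  have w1 : ω.windC (cHi w) = ω.windC q1 := by
    refine windC_eq_of_subset_sideSeg_free hh h hS ?_ ?_ (prefix_nth_ne_of_not_mem h (Or.inl ?_)) hP1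
    · obtain ⟨a, b⟩ := w; simp [holeFaceW, Face.side]
    · obtain ⟨a, b⟩ := w; simp [holeFaceW, Face.side]
    · have : ((holeFaceW w).side .N).faces.1 = holeFaceW w := by
        obtain ⟨a, b⟩ := w; simp [holeFaceW, Face.side, MidEdge.faces]
      rw [this]; exact hh
  -- the right half of the top side of the far cell: not the first side
  have hP2 : segment ℝ q1 mN ⊆ sideSeg (farW w) .N := by
    refine (convex_segment _ _).segment_subset ?_ (toC_midPt_side_mem_sideSeg _ _)
    have e : q1 = toC ((farW w).base + Side.N.endB) := by
      rw [hq1]; congr 1; obtain ⟨a, b⟩ := w; simp [holeFaceW, farW, Face.base, Side.endA, Side.endB]; ring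
    rw [e]; exact right_mem_segment _ _ _
  have w2 : ω.windC q1 = ω.windC mN := by
    refine windC_eq_of_subset_sideSeg_free hh h hS ?_ ?_ (prefix_nth_ne_farW_side h hS (by decide)) hP2
    · obtain ⟨a, b⟩ := w; simp [holeFaceW, farW, Face.side]
    · obtain ⟨a, b⟩ := w; simp [farW, Face.side]
  -- the midpoint lies on `J`
  obtain ⟨j₀, hj₀, hj₀e⟩ := exists_jOut_eq_farW_N hh hr h hS
  have wN : ω.windC mN = ω.windC (ω.pJ hr h 0) := by
    refine windC_pJ_edge hh hr h hS (k := 2 * j₀) (by omega) ?_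
    rw [segment_pJ_even h hj₀, hj₀e]
    exact toC_midPt_mem_crossSeg _
  rw [w1, w2, wN]

/-- ★★ **…and NOT the one about the LOWER corner** (the two differ by one: `windC_jump`).
[cite: AhlforsCA1979, Ch. 4 §2.1 (index of a point with respect to a closed curve)] -/
theorem windC_cLo_ne_windC_pJ (hh : holeFaceW w ∉ D) (hr : RootedFace D (w.side .W) (farW w)) (h : ω.IsB2a)
    (hS : ω.2.firstSideG = .S) : ω.windC (cLo w) ≠ ω.windC (ω.pJ hr h 0) := by
  intro e
  have := windC_jump hh h hS
  rw [windC_cHi_eq_windC_pJ hh hr h hS, ← e, sub_self] at this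
  exact zero_ne_one this

/-- ★★ **No point joined to the lower corner of the root edge by a free chain lies on the excursion polygon.**
[cite: CourantRobbins1958, Ch. V Appendix §2 (The Jordan Curve Theorem for Polygons: the even–odd rule)]
[cite: AhlforsCA1979, Ch. 4 §2.1 (index of a point with respect to a closed curve)] -/
theorem not_mem_pJ_edge_of_chain (hh : holeFaceW w ∉ D) (hr : RootedFace D (w.side .W) (farW w)) (h : ω.IsB2a)
    (hS : ω.2.firstSideG = .S) {P : ℕ → ℂ} {c : ℕ → Face} {s : ℕ → Side} {K : ℕ} (hP0 : P 0 = cLo w)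
    (hseg : ∀ k, k < K → segment ℝ (P k) (P (k + 1)) ⊆ sideSeg (c k) (s k))
    (h1 : ∀ k, k < K → (c k).side (s k) ≠ (holeFaceW w).side .W) (h2 : ∀ k, k < K → (c k).side (s k) ≠ w.side .W)
    (hpre : ∀ k, k < K → ∀ i, 1 ≤ i → i ≤ ω.2.firstHitG → ω.2.nth i ≠ (c k).side (s k))
    {k : ℕ} (hk : k < 2 * ω.Mv) : P K ∉ segment ℝ (ω.pJ hr h k) (ω.pJ hr h (k + 1)) := by
  intro hz
  have e1 := windC_chain hh h hS hseg h1 h2 hpre K le_rfl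
  have e2 := windC_pJ_edge hh hr h hS hk hz
  rw [hP0] at e1
  exact windC_cLo_ne_windC_pJ hh hr h hS (e1.symm.trans e2)

/-! ## §4 The general separation lemma -/

/-- ★★★★★ **THE GENERAL PREFIX-LOOP SEPARATION LEMMA.** Hole absent; `ω` a class-`B2a` UNDER-walk at the far cell (first
side `S`); a chain of points `P 0 = cLo w, P 1, …, P K`, each segment `[P k, P (k + 1)]` inside a closed lattice side
`(c k).side (s k)` that is neither the hole's `W` side nor the root edge and is NO PREFIX MID-EDGE (dischargers: dead
sides `prefix_nth_ne_of_not_mem`, exit mid-edges of slots `prefix_nth_ne_of_exit`, far-cell sides `prefix_nth_ne_farW_side`);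
the last point `P K` lying on a closed side `c'.side s'` which IS THE EXIT MID-EDGE OF A SLOT of the excursion polygon.
Contradiction: `C` has one winding number along the chain (§2) and along the last side up to its midpoint (an exit
mid-edge is free: §1), which lies on `J`, where `C`'s winding number is the one about the upper corner (§3) — but the two
corners' winding numbers differ by one (`windC_jump`). The four separations of the parent files are the chains
`[w.S, rootE.S∣]`, `[rootS.W, rootSS.W∣]`, `[w.S, …, (x₁−1, w.2).S, (x₁, w.2).S∣]`, `[rootS.W, …, (w.1, y₁).W∣]`.
[cite: CourantRobbins1958, Ch. V Appendix §2 (The Jordan Curve Theorem for Polygons: the even–odd rule)]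
[cite: AhlforsCA1979, Ch. 4 §2.1 (index of a point with respect to a closed curve)]
[cite: Glazman2015WeightedSAW, Lemma 3.1 (proof, pp. 6–7: the classes of walks through a rhombus)] -/
theorem false_of_free_chain_exit (hh : holeFaceW w ∉ D) (hr : RootedFace D (w.side .W) (farW w)) (h : ω.IsB2a)
    (hS : ω.2.firstSideG = .S) {P : ℕ → ℂ} {c : ℕ → Face} {s : ℕ → Side} {K : ℕ} (hP0 : P 0 = cLo w)
    (hseg : ∀ k, k < K → segment ℝ (P k) (P (k + 1)) ⊆ sideSeg (c k) (s k))
    (h1 : ∀ k, k < K → (c k).side (s k) ≠ (holeFaceW w).side .W) (h2 : ∀ k, k < K → (c k).side (s k) ≠ w.side .W)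
    (hpre : ∀ k, k < K → ∀ i, 1 ≤ i → i ≤ ω.2.firstHitG → ω.2.nth i ≠ (c k).side (s k))
    {c' : Face} {s' : Side} (hend : P K ∈ sideSeg c' s')
    (hJ : ∃ j, j < ω.Mv ∧ (ω.jFace h j).side (ω.jOut hr h j) = c'.side s') : False := by
  have hM := ω.three_le_Mv hr h
  obtain ⟨j, hj, hje⟩ := hJ
  -- extend the chain by the sub-segment of the last side from `P K` to its midpoint
  set m : ℂ := toC (midPt (c'.side s')) with hm
  have hlast : segment ℝ (P K) m ⊆ sideSeg c' s' :=
    (convex_segment _ _).segment_subset hend (toC_midPt_side_mem_sideSeg _ _)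
  have e1 := windC_chain hh h hS hseg h1 h2 hpre K le_rfl
  have e2 : ω.windC (P K) = ω.windC m :=
    windC_eq_of_subset_sideSeg_free hh h hS (by rw [← hje]; exact exit_ne_holeFaceW_W hh hr h hS hj)
      (by rw [← hje]; exact exit_ne_root_W hr h hj) (prefix_nth_ne_of_exit hr h ⟨j, hj, hje⟩) hlast
  have e3 : ω.windC m = ω.windC (ω.pJ hr h 0) := by
    refine windC_pJ_edge hh hr h hS (k := 2 * j) (by omega) ?_
    rw [segment_pJ_even h hj, hje]
    exact toC_midPt_mem_crossSeg _
  rw [hP0] at e1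
  exact windC_cLo_ne_windC_pJ hh hr h hS (e1.symm.trans (e2.trans e3))

/-- ★★★★★ **THE GENERAL SEPARATION LEMMA, CORNER FORM.** The chain is a lattice path: corners `q 0 = (w.1, w.2)` (the lower
corner of the root edge), `q 1, …, q K`, consecutive corners joined by a unit step whose closed side `(c k).side (s k)`
(`segment_cornerPt_east/north/west/south`) is neither the hole's `W` side nor the root edge and is no prefix mid-edge;
the last corner `q K` is a corner of a closed side `c'.side s'` which is the exit mid-edge of a slot of `J`. Contradiction.
[cite: CourantRobbins1958, Ch. V Appendix §2 (The Jordan Curve Theorem for Polygons: the even–odd rule)]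
[cite: AhlforsCA1979, Ch. 4 §2.1 (index of a point with respect to a closed curve)] -/
theorem false_of_cornerChain_exit (hh : holeFaceW w ∉ D) (hr : RootedFace D (w.side .W) (farW w)) (h : ω.IsB2a)
    (hS : ω.2.firstSideG = .S) {q : ℕ → ℤ × ℤ} {c : ℕ → Face} {s : ℕ → Side} {K : ℕ} (hq0 : q 0 = w)
    (hseg : ∀ k, k < K → segment ℝ (toC (cornerPt (q k))) (toC (cornerPt (q (k + 1)))) = sideSeg (c k) (s k))
    (h1 : ∀ k, k < K → (c k).side (s k) ≠ (holeFaceW w).side .W) (h2 : ∀ k, k < K → (c k).side (s k) ≠ w.side .W)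
    (hpre : ∀ k, k < K → ∀ i, 1 ≤ i → i ≤ ω.2.firstHitG → ω.2.nth i ≠ (c k).side (s k))
    {c' : Face} {s' : Side} (hend : cornerPt (q K) = c'.base + s'.endA ∨ cornerPt (q K) = c'.base + s'.endB)
    (hJ : ∃ j, j < ω.Mv ∧ (ω.jFace h j).side (ω.jOut hr h j) = c'.side s') : False := by
  refine false_of_free_chain_exit hh hr h hS (P := fun k => toC (cornerPt (q k))) (c := c) (s := s) (K := K)
    (by show toC (cornerPt (q 0)) = cLo w; rw [hq0, cLo_eq_toC_cornerPt]) (fun k hk => (hseg k hk).le) h1 h2 hpre ?_ hJ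
  rcases hend with e | e
  · simp only [e]; exact toC_cornerPt_mem_sideSeg_endA c' s'
  · simp only [e]; exact toC_cornerPt_mem_sideSeg_endB c' s'

/-! ## §5 First consequences: the lower-corner law and the two order laws -/

/-- ★★★★ **THE LOWER-CORNER LAW, bottom side of the root plaquette**: hole absent, `ω` a class-`B2a` UNDER-walk at the far
cell. Then no slot of its excursion polygon exits through `w.side S` (the lower corner of the root edge is a corner of that
side: a chain of length zero). [cite: CourantRobbins1958, Ch. V Appendix §2 (The Jordan Curve Theorem for Polygons: the even–odd rule)]
[cite: Glazman2015WeightedSAW, Lemma 3.1 (proof, pp. 6–7: the classes of walks through a rhombus)] -/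
theorem exit_ne_root_S_of_under (hh : holeFaceW w ∉ D) (hr : RootedFace D (w.side .W) (farW w)) (h : ω.IsB2a)
    (hS : ω.2.firstSideG = .S) {j : ℕ} (hj : j < ω.Mv) : (ω.jFace h j).side (ω.jOut hr h j) ≠ w.side .S := by
  intro e
  refine false_of_free_chain_exit hh hr h hS (P := fun _ => cLo w) (c := fun _ => w) (s := fun _ => Side.S) (K := 0)
    rfl (fun k hk => absurd hk (Nat.not_lt_zero k)) (fun k hk => absurd hk (Nat.not_lt_zero k))
    (fun k hk => absurd hk (Nat.not_lt_zero k)) (fun k hk => absurd hk (Nat.not_lt_zero k)) (c' := w) (s' := .S) ?_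
    ⟨j, hj, e⟩
  show cLo w ∈ sideSeg w .S
  exact left_mem_segment _ _ _

/-- ★★★★ **THE LOWER-CORNER LAW, west side of `rootS`**: hole absent, `ω` a class-`B2a` under-walk at the far cell. Then no
slot of its excursion polygon exits through the west side of `rootS w = (w.1, w.2 − 1)` (whose upper corner is the lower
corner of the root edge). [cite: CourantRobbins1958, Ch. V Appendix §2 (The Jordan Curve Theorem for Polygons: the even–odd rule)]
[cite: Glazman2015WeightedSAW, Lemma 3.1 (proof, pp. 6–7: the classes of walks through a rhombus)] -/
theorem exit_ne_rootS_W_of_under (hh : holeFaceW w ∉ D) (hr : RootedFace D (w.side .W) (farW w)) (h : ω.IsB2a)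
    (hS : ω.2.firstSideG = .S) {j : ℕ} (hj : j < ω.Mv) : (ω.jFace h j).side (ω.jOut hr h j) ≠ (rootS w).side .W := by
  intro e
  refine false_of_free_chain_exit hh hr h hS (P := fun _ => cLo w) (c := fun _ => w) (s := fun _ => Side.S) (K := 0)
    rfl (fun k hk => absurd hk (Nat.not_lt_zero k)) (fun k hk => absurd hk (Nat.not_lt_zero k))
    (fun k hk => absurd hk (Nat.not_lt_zero k)) (fun k hk => absurd hk (Nat.not_lt_zero k)) (c' := rootS w) (s' := .W) ?_
    ⟨j, hj, e⟩
  show cLo w ∈ sideSeg (rootS w) .W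
  have e1 : cLo w = toC ((rootS w).base + Side.W.endB) := by
    rw [cLo]; congr 1; obtain ⟨a, b⟩ := w; simp [rootS, Face.base, Side.endA, Side.endB]; ring
  rw [e1]; exact right_mem_segment _ _ _

/-- ★★★★★ **THE ORDER LAW ON THE EASTERN RAY.** Hole absent, `ω` a class-`B2a` UNDER-walk at the far cell; a slot of its
excursion polygon exits through the ray edge `slant x' w.2`, `x' ≥ w.1` (the bottom side of the cell `(x', w.2)` of the root
row). Then the PREFIX crosses a ray edge strictly west of it and east of the hole: `nth i = slant x w.2` for some
`w.1 ≤ x < x'`, `1 ≤ i ≤ F` (chain: the bottom sides of the columns `w.1, …, x' − 1`, corner to corner).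
[cite: CourantRobbins1958, Ch. V Appendix §2 (The Jordan Curve Theorem for Polygons: the even–odd rule)]
[cite: AhlforsCA1979, Ch. 4 §2.1 (index of a point with respect to a closed curve)]
[cite: Glazman2015WeightedSAW, Lemma 3.1 (proof, pp. 6–7: the classes of walks through a rhombus)] -/
theorem exists_prefix_nth_eq_slant_lt_of_exit (hh : holeFaceW w ∉ D) (hr : RootedFace D (w.side .W) (farW w))
    (h : ω.IsB2a) (hS : ω.2.firstSideG = .S) {x' : ℤ} (hx' : w.1 ≤ x')
    (hJ : ∃ j, j < ω.Mv ∧ (ω.jFace h j).side (ω.jOut hr h j) = MidEdge.slant x' w.2) :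
    ∃ x : ℤ, ∃ i : ℕ, w.1 ≤ x ∧ x < x' ∧ 1 ≤ i ∧ i ≤ ω.2.firstHitG ∧ ω.2.nth i = MidEdge.slant x w.2 := by
  by_contra hP
  push Not at hP
  set K : ℕ := (x' - w.1).toNat with hKdef
  have hK : (K : ℤ) = x' - w.1 := by rw [hKdef]; omega
  refine false_of_cornerChain_exit hh hr h hS (q := fun k => (w.1 + k, w.2)) (c := fun k => ((w.1 + k, w.2) : Face))
    (s := fun _ => Side.S) (K := K) (by simp) (fun k hk => ?_) (fun k hk => ?_) (fun k hk => ?_)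
    (fun k hk i hi1 hiF => hP (w.1 + k) i (by omega) (by omega) hi1 hiF) (c' := ((x', w.2) : Face)) (s' := .S)
    (Or.inl ?_) hJ
  · have := segment_cornerPt_east ((w.1 + k, w.2) : ℤ × ℤ)
    simp only [Nat.cast_add, Nat.cast_one] at this ⊢
    rw [← add_assoc] ; exact this
  · obtain ⟨a, b⟩ := w; simp [holeFaceW, Face.side]
  · obtain ⟨a, b⟩ := w; simp [Face.side]
  · simp only [cornerPt, Face.base, Side.endA, hK, add_sub_cancel, Prod.mk_add_mk, add_zero]

/-- ★★★★★ **THE ORDER LAW ON THE ROOT COLUMN BELOW THE ROOT ROW.** Hole absent, `ω` a class-`B2a` UNDER-walk at the far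
cell; a slot of its excursion polygon exits through the west side `vert w.1 y'` of the cell `(w.1, y')`, `y' ≤ w.2 − 1`, of
the root column. Then the PREFIX crosses a west side of that column strictly above it and below the root row:
`nth i = vert w.1 y` for some `y' < y ≤ w.2 − 1`, `1 ≤ i ≤ F` (chain: straight down from the lower corner of the root edge).
[cite: CourantRobbins1958, Ch. V Appendix §2 (The Jordan Curve Theorem for Polygons: the even–odd rule)]
[cite: AhlforsCA1979, Ch. 4 §2.1 (index of a point with respect to a closed curve)]
[cite: Glazman2015WeightedSAW, Lemma 3.1 (proof, pp. 6–7: the classes of walks through a rhombus)] -/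
theorem exists_prefix_nth_eq_vert_gt_of_exit (hh : holeFaceW w ∉ D) (hr : RootedFace D (w.side .W) (farW w))
    (h : ω.IsB2a) (hS : ω.2.firstSideG = .S) {y' : ℤ} (hy' : y' ≤ w.2 - 1)
    (hJ : ∃ j, j < ω.Mv ∧ (ω.jFace h j).side (ω.jOut hr h j) = MidEdge.vert w.1 y') :
    ∃ y : ℤ, ∃ i : ℕ, y' < y ∧ y ≤ w.2 - 1 ∧ 1 ≤ i ∧ i ≤ ω.2.firstHitG ∧ ω.2.nth i = MidEdge.vert w.1 y := by
  by_contra hP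
  push Not at hP
  set K : ℕ := (w.2 - 1 - y').toNat with hKdef
  have hK : (K : ℤ) = w.2 - 1 - y' := by rw [hKdef]; omega
  refine false_of_cornerChain_exit hh hr h hS (q := fun k => (w.1, w.2 - k)) (c := fun k => ((w.1, w.2 - k - 1) : Face))
    (s := fun _ => Side.W) (K := K) (by simp) (fun k hk => ?_) (fun k hk => ?_) (fun k hk => ?_)
    (fun k hk i hi1 hiF => hP (w.2 - k - 1) i (by omega) (by omega) hi1 hiF) (c' := ((w.1, y') : Face)) (s' := .W)
    (Or.inr ?_) hJ
  · have := segment_cornerPt_south ((w.1, w.2 - k) : ℤ × ℤ)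
    simp only [Nat.cast_add, Nat.cast_one] at this ⊢
    rw [show w.2 - (k + 1 : ℤ) = w.2 - k - 1 by ring]; exact this
  · obtain ⟨a, b⟩ := w; simp [holeFaceW, Face.side]; omega
  · obtain ⟨a, b⟩ := w; simp [Face.side]; omega
  · simp only [cornerPt, Face.base, Side.endB, hK, Prod.mk_add_mk, add_zero, Prod.mk.injEq, true_and]; ring

end ΩG

end Literature.Probability.RandomPlanarGeometry.SAW.YangBaxter
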